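import Literature.Probability.Percolation.PortLinkQuad
import HarnessLib

/-!
# Re-basing the traced loop: every pair of distinct ports is a pair of marked arcs

Topic `Probability/Percolation`.  Support file (proofs, no named fact) for step (C) of the proof of
Schramm–Smirnov's Prop. 4.1 (Ann. Probab. 39 (2011), §4, the graph `G*`).  The objects attached to
the traced boundary loop of a tile domain (`outCell`, hub contacts, open sides, `SamePort`, `Bit`,
`PortBit`) are transported along a change of base dart `d₀ ↦ bdOrbit U d₀ r` (the period is
unchanged, indices shift by `r`), and for any two hub contacts in different ports a base and arcs
`0 = a₀ < a₁ < a₂ < a₃ < P` are produced for which the two ports are exactly the arcs `[a₃, P)` and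
`[a₁, a₂)` flanked by non-open sides (`exists_rebase`), so that `portBit_iff_linkQuad_mem`
(`PortLinkQuad.lean`) applies to every port-level bit.

## References

* O. Schramm, S. Smirnov, *On the scaling limits of planar percolation*, Ann. Probab. 39 (2011)
  1768–1814, arXiv:1101.5820, §4, proof of Prop. 4.1. [SchrammSmirnov2011]
-/

noncomputable section

open Set Relation
open Literature.Probability.LatticeModels
open scoped Classical

namespace Literature.Probability.Percolation

namespace CellComplex

/-! ### The period is invariant under re-basing -/

section Rebase

variable {U : Finset (Site 2)} {d₀ : Site 2 × Fin 4} (h₀ : IsBd U d₀) (r : ℕ)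

/-- The orbit from the re-based dart. [folklore] -/
theorem bdOrbit_rebase (n : ℕ) : bdOrbit U (bdOrbit U d₀ r) n = bdOrbit U d₀ (r + n) := by
  rw [bdOrbit_add]

/-- **The minimal period does not depend on the base point of the orbit.** [folklore] -/
theorem period_rebase : period (isBd_bdOrbit h₀ r) = period h₀ := by
  classical
  set P := period h₀ with hP
  set P' := period (isBd_bdOrbit h₀ r) with hP'
  have hP0 : 0 < P := period_pos h₀
  have hP'0 : 0 < P' := period_pos _
  -- `P` is a period of the re-based orbit
  have h1 : bdOrbit U (bdOrbit U d₀ r) P = bdOrbit U d₀ r := by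
    rw [bdOrbit_rebase, bdOrbit_add_period h₀]
  have hle : P' ≤ P := by
    rw [hP', period]
    exact Nat.find_min' _ ⟨hP0, h1⟩
  -- `P'` shifts `r` by a multiple of `P`
  have h2 : bdOrbit U d₀ (r + P') = bdOrbit U d₀ r := by
    rw [← bdOrbit_rebase]; exact bdOrbit_period _
  have h3 : (r + P') % P = r % P := by
    have := bdOrbit_injOn h₀ (Nat.mod_lt (r + P') hP0) (Nat.mod_lt r hP0)
      (by rw [bdOrbit_mod h₀, bdOrbit_mod h₀, h2])
    exact this
  -- hence `P' = P`
  rcases hle.lt_or_eq with hlt | heq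
  · exfalso
    rw [Nat.add_mod] at h3
    have hr : r % P < P := Nat.mod_lt _ hP0
    rw [Nat.mod_eq_of_lt hlt] at h3
    by_cases h : r % P + P' < P
    · rw [Nat.mod_eq_of_lt h] at h3; omega
    · push Not at h
      rw [Nat.mod_eq_sub_mod h, Nat.mod_eq_of_lt (by omega)] at h3
      omega
  · exact heq

end Rebase

namespace TileData

open QuadCrossing

variable {𝒯 : TileData} {d₀ : Site 2 × Fin 4}

/-! ### Transport of the loop objects along a change of base -/

/-- The out-cells of the re-based loop. [folklore] -/
theorem outCell_rebase (r n : ℕ) : 𝒯.outCell (bdOrbit 𝒯.U d₀ r) n = 𝒯.outCell d₀ (r + n) := by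
  simp only [TileData.outCell, vert, dirAt, bdOrbit_rebase]

/-- The edge segments of the re-based loop. [folklore] -/
theorem edgeSeg_rebase (r n : ℕ) :
    edgeSeg (vert 𝒯.U (bdOrbit 𝒯.U d₀ r) n) (dirAt 𝒯.U (bdOrbit 𝒯.U d₀ r) n) = edgeSeg (vert 𝒯.U d₀ (r + n)) (dirAt 𝒯.U d₀ (r + n)) := by
  simp only [vert, dirAt, bdOrbit_rebase]

/-- Hub contacts of the re-based loop. [folklore] -/
theorem hubContact_rebase (r n : ℕ) : 𝒯.hubContact (bdOrbit 𝒯.U d₀ r) n ↔ 𝒯.hubContact d₀ (r + n) := by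
  rw [TileData.hubContact, TileData.hubContact, outCell_rebase]

/-- Open sides of the re-based loop. [folklore] -/
theorem isOpenSide_rebase (r n : ℕ) : 𝒯.IsOpenSide (bdOrbit 𝒯.U d₀ r) n ↔ 𝒯.IsOpenSide d₀ (r + n) := by
  rw [IsOpenSide, IsOpenSide, hubContact_rebase, outCell_rebase]

/-- Bits of the re-based loop. [folklore] -/
theorem bit_rebase {η : BondConfig (Site 2)} (r i j : ℕ) :
    𝒯.Bit (bdOrbit 𝒯.U d₀ r) η i j ↔ 𝒯.Bit d₀ η (r + i) (r + j) := by
  simp only [Bit, DockAt, edgeSeg_rebase]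

/-- `SamePort` along the re-based loop implies `SamePort` along the original one. [folklore] -/
theorem samePort_of_rebase (h₀ : IsBd 𝒯.U d₀) (r : ℕ) {i j : ℕ}
    (h : 𝒯.SamePort (bdOrbit 𝒯.U d₀ r) (isBd_bdOrbit h₀ r) i j) : 𝒯.SamePort d₀ h₀ (r + i) (r + j) := by
  obtain ⟨a, b, lo, hi, h1, h2, h3, h4, hopen⟩ := h
  rw [period_rebase h₀ r] at h1 h2 h3 h4
  refine ⟨a, b, r + lo, r + hi, by omega, by omega, by omega, by omega, fun l hl1 hl2 => ?_⟩
  have := hopen (l - r) (by omega) (by omega)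
  rwa [isOpenSide_rebase, show r + (l - r) = l by omega] at this

/-- `SamePort` along the original loop implies `SamePort` along the re-based one. [folklore] -/
theorem samePort_rebase_of (h₀ : IsBd 𝒯.U d₀) (r : ℕ) {i j : ℕ}
    (h : 𝒯.SamePort d₀ h₀ (r + i) (r + j)) : 𝒯.SamePort (bdOrbit 𝒯.U d₀ r) (isBd_bdOrbit h₀ r) i j := by
  obtain ⟨a, b, lo, hi, h1, h2, h3, h4, hopen⟩ := h
  have hP0 : 0 < period h₀ := period_pos h₀
  -- shift everything up by `r` periods so that `lo - r` makes sense
  set rp := r * period h₀ with hrp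
  have hrP : r ≤ rp := by rw [hrp]; exact Nat.le_mul_of_pos_right r hP0
  have e1 : (a + r) * period h₀ = a * period h₀ + rp := by rw [hrp]; ring
  have e2 : (b + r) * period h₀ = b * period h₀ + rp := by rw [hrp]; ring
  refine ⟨a + r, b + r, lo + rp - r, hi + rp - r, ?_, ?_, ?_, ?_, fun l hl1 hl2 => ?_⟩
  · rw [period_rebase h₀ r, e1]; omega
  · rw [period_rebase h₀ r, e1]; omega
  · rw [period_rebase h₀ r, e2]; omega
  · rw [period_rebase h₀ r, e2]; omega
  · rw [isOpenSide_rebase]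
    have := hopen (r + l - rp) (by omega) (by omega)
    rw [← isOpenSide_add_mul_period h₀ _ r, ← hrp] at this
    rwa [show r + l - rp + rp = r + l by omega] at this

/-- Bits are periodic in each index. [folklore] -/
theorem bit_add_mul_period (h₀ : IsBd 𝒯.U d₀) {η : BondConfig (Site 2)} (i j p q : ℕ) :
    𝒯.Bit d₀ η (i + p * period h₀) (j + q * period h₀) ↔ 𝒯.Bit d₀ η i j := by
  have h := fun n => edgeSeg_mod (𝒯 := 𝒯) h₀ n
  have hi : edgeSeg (vert 𝒯.U d₀ (i + p * period h₀)) (dirAt 𝒯.U d₀ (i + p * period h₀)) = edgeSeg (vert 𝒯.U d₀ i) (dirAt 𝒯.U d₀ i) := by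
    rw [← h (i + p * period h₀), Nat.add_mul_mod_self_right, h i]
  have hj : edgeSeg (vert 𝒯.U d₀ (j + q * period h₀)) (dirAt 𝒯.U d₀ (j + q * period h₀)) = edgeSeg (vert 𝒯.U d₀ j) (dirAt 𝒯.U d₀ j) := by
    rw [← h (j + q * period h₀), Nat.add_mul_mod_self_right, h j]
  simp only [Bit, DockAt, hi, hj]

/-- `SamePort` is invariant under adding periods to the second index. [folklore] -/
theorem samePort_add_mul_period_right (h₀ : IsBd 𝒯.U d₀) {n m : ℕ} (q : ℕ) :
    𝒯.SamePort d₀ h₀ n (m + q * period h₀) ↔ 𝒯.SamePort d₀ h₀ n m := by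
  constructor
  · rintro ⟨a, b, lo, hi, h1, h2, h3, h4, hopen⟩
    exact ⟨a, b + q, lo, hi, h1, h2, by rw [add_mul]; linarith, by rw [add_mul]; linarith, hopen⟩
  · rintro ⟨a, b, lo, hi, h1, h2, h3, h4, hopen⟩
    refine ⟨a + q, b, lo + q * period h₀, hi + q * period h₀, by rw [add_mul]; linarith, by rw [add_mul]; linarith,
      by linarith, by linarith, fun l hl1 hl2 => ?_⟩
    have := hopen (l - q * period h₀) (by omega) (by omega)
    rwa [← isOpenSide_add_mul_period h₀ _ q, show l - q * period h₀ + q * period h₀ = l by omega] at this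

/-- **Port-level bits along the re-based loop are the port-level bits of the original loop.** [folklore] -/
theorem portBit_rebase (h₀ : IsBd 𝒯.U d₀) {η : BondConfig (Site 2)} (r i j : ℕ) :
    𝒯.PortBit (bdOrbit 𝒯.U d₀ r) (isBd_bdOrbit h₀ r) η i j ↔ 𝒯.PortBit d₀ h₀ η (r + i) (r + j) := by
  constructor
  · rintro ⟨hi, hj, hns, i', j', hii', hjj', hbit⟩
    exact ⟨(hubContact_rebase r i).1 hi, (hubContact_rebase r j).1 hj, fun h => hns (samePort_rebase_of h₀ r h),
      r + i', r + j', samePort_of_rebase h₀ r hii', samePort_of_rebase h₀ r hjj', (bit_rebase r i' j').1 hbit⟩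
  · rintro ⟨hi, hj, hns, i', j', hii', hjj', hbit⟩
    have hP0 : 0 < period h₀ := period_pos h₀
    set rp := r * period h₀ with hrp
    have hrP : r ≤ rp := by rw [hrp]; exact Nat.le_mul_of_pos_right r hP0
    -- representatives `r + i''`, `r + j''` of `i'`, `j'` modulo the period
    refine ⟨(hubContact_rebase r i).2 hi, (hubContact_rebase r j).2 hj, fun h => hns (samePort_of_rebase h₀ r h),
      i' + rp - r, j' + rp - r, samePort_rebase_of h₀ r ?_, samePort_rebase_of h₀ r ?_, ?_⟩
    · rw [show r + (i' + rp - r) = i' + r * period h₀ by omega, samePort_add_mul_period_right h₀]; exact hii'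
    · rw [show r + (j' + rp - r) = j' + r * period h₀ by omega, samePort_add_mul_period_right h₀]; exact hjj'
    · rw [bit_rebase, show r + (i' + rp - r) = i' + r * period h₀ by omega, show r + (j' + rp - r) = j' + r * period h₀ by omega,
        bit_add_mul_period h₀]
      exact hbit

/-! ### Maximal open stretches -/

/-- The maximal open stretch to the right of an open side, stopped by a non-open side. [folklore] -/
theorem exists_openStretch_right {x c : ℕ} (hx : 𝒯.IsOpenSide d₀ x) (hxc : x < c) (hc : ¬ 𝒯.IsOpenSide d₀ c) :
    ∃ h, x ≤ h ∧ h < c ∧ (∀ l, x ≤ l → l ≤ h → 𝒯.IsOpenSide d₀ l) ∧ ¬ 𝒯.IsOpenSide d₀ (h + 1) := by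
  classical
  -- the first non-open index after `x`
  have hex : ∃ n, x < n ∧ ¬ 𝒯.IsOpenSide d₀ n := ⟨c, hxc, hc⟩
  set n := Nat.find hex with hn
  obtain ⟨hxn, hnopen⟩ := Nat.find_spec hex
  have hmin : ∀ m, x < m → m < n → 𝒯.IsOpenSide d₀ m := fun m h1 h2 => by
    by_contra h; exact Nat.find_min hex h2 ⟨h1, h⟩
  have hnc : n ≤ c := Nat.find_min' hex ⟨hxc, hc⟩
  refine ⟨n - 1, by omega, by omega, fun l hl1 hl2 => ?_, by rwa [show n - 1 + 1 = n by omega]⟩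
  rcases (Nat.eq_or_lt_of_le hl1) with rfl | hlt
  · exact hx
  · exact hmin l hlt (by omega)

/-- The maximal open stretch to the left of an open side, stopped by a non-open side. [folklore] -/
theorem exists_openStretch_left {x c : ℕ} (hx : 𝒯.IsOpenSide d₀ x) (hcx : c < x) (hc : ¬ 𝒯.IsOpenSide d₀ c) :
    ∃ lo, c < lo ∧ lo ≤ x ∧ (∀ l, lo ≤ l → l ≤ x → 𝒯.IsOpenSide d₀ l) ∧ ¬ 𝒯.IsOpenSide d₀ (lo - 1) := by
  classical
  -- the last non-open index before `x`
  set n := Nat.findGreatest (fun n => ¬ 𝒯.IsOpenSide d₀ n) x with hn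
  have hcn : c ≤ n := Nat.le_findGreatest hcx.le hc
  have hnx : n ≤ x := Nat.findGreatest_le _
  have hnopen : ¬ 𝒯.IsOpenSide d₀ n := Nat.findGreatest_spec (P := fun n => ¬ 𝒯.IsOpenSide d₀ n) hcx.le hc
  have hnx' : n < x := lt_of_le_of_ne hnx fun h => hnopen (h ▸ hx)
  have hmax : ∀ m, n < m → m ≤ x → 𝒯.IsOpenSide d₀ m := fun m h1 h2 => by
    by_contra h
    exact absurd (Nat.le_findGreatest h2 h) (by rw [← hn]; omega)
  exact ⟨n + 1, by omega, by omega, fun l hl1 hl2 => hmax l (by omega) hl2, by rw [Nat.add_sub_cancel]; exact hnopen⟩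

/-! ### Every pair of distinct ports is a pair of marked arcs after re-basing -/

/-- **Re-basing for a pair of ports.**  For hub contacts `i, j < P` of different ports there are a
shift `r` and arcs `0 = a₀ < a₁ < a₂ < a₃ < P` of the loop based at `bdOrbit U d₀ r` such that the
port of `i` is the final arc `[a₃, P)` and the port of `j` the arc `[a₁, a₂)`, both open inside and
flanked by non-open sides, with `i ↦ i'`, `j ↦ j'` in these arcs. [folklore] -/
theorem exists_rebase (h₀ : IsBd 𝒯.U d₀) {i j : ℕ} (hiP : i < period h₀) (hjP : j < period h₀)
    (hi : 𝒯.hubContact d₀ i) (hj : 𝒯.hubContact d₀ j) (hns : ¬ 𝒯.SamePort d₀ h₀ i j) :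
    ∃ (r : ℕ) (a : Fin 4 → ℕ) (i' j' : ℕ), a 0 = 0 ∧ StrictMono a ∧ a 3 < period h₀ ∧
      (a 3 ≤ i' ∧ i' < period h₀) ∧ (a 1 ≤ j' ∧ j' < a 2) ∧ r + i' = i + 2 * period h₀ ∧
      (∃ q, r + j' = j + q * period h₀) ∧
      (∀ l, a 3 ≤ l → l < period h₀ → 𝒯.IsOpenSide (bdOrbit 𝒯.U d₀ r) l) ∧
      (∀ l, a 1 ≤ l → l < a 2 → 𝒯.IsOpenSide (bdOrbit 𝒯.U d₀ r) l) ∧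
      ¬ 𝒯.IsOpenSide (bdOrbit 𝒯.U d₀ r) 0 ∧ ¬ 𝒯.IsOpenSide (bdOrbit 𝒯.U d₀ r) (a 1 - 1) ∧
      ¬ 𝒯.IsOpenSide (bdOrbit 𝒯.U d₀ r) (a 2) ∧ ¬ 𝒯.IsOpenSide (bdOrbit 𝒯.U d₀ r) (a 3 - 1) := by
  set P := period h₀ with hP
  have hP0 : 0 < P := period_pos h₀
  have hiO : 𝒯.IsOpenSide d₀ i := Or.inl hi
  have hjO : 𝒯.IsOpenSide d₀ j := Or.inl hj
  have hper : ∀ n q, 𝒯.IsOpenSide d₀ (n + q * P) ↔ 𝒯.IsOpenSide d₀ n := isOpenSide_add_mul_period h₀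
  have hper1 : ∀ n, 𝒯.IsOpenSide d₀ (n + P) ↔ 𝒯.IsOpenSide d₀ n := fun n => by
    rw [show n + P = n + 1 * P by ring]; exact hper n 1
  -- there is a non-open side `c < P` (otherwise `i`, `j` share the port "everything")
  obtain ⟨c, hcP, hc⟩ : ∃ c, c < P ∧ ¬ 𝒯.IsOpenSide d₀ c := by
    by_contra hall
    push Not at hall
    exact hns ⟨0, 0, 0, P - 1, by omega, by omega, by omega, by omega, fun l _ hl => hall l (by omega)⟩
  have hci : c ≠ i := fun h => hc (h ▸ hiO)
  -- the port of `I := i + P`: closed sides `c + P`, `c` or `c + 2P` within a period on both sides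
  set I := i + P with hI
  have hIO : 𝒯.IsOpenSide d₀ I := by rw [hI, hper1]; exact hiO
  have hcP1 : ¬ 𝒯.IsOpenSide d₀ (c + P) := by rw [hper1]; exact hc
  have hcP2 : ¬ 𝒯.IsOpenSide d₀ (c + P + P) := by rw [hper1, hper1]; exact hc
  obtain ⟨hiI, hIhi, hhiIP, hopenR, hcloseR⟩ : ∃ h, I ≤ h ∧ h + 1 < I + P ∧ (∀ l, I ≤ l → l ≤ h → 𝒯.IsOpenSide d₀ l) ∧
      ¬ 𝒯.IsOpenSide d₀ (h + 1) := by
    by_cases hcase : i < c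
    · obtain ⟨h, h1, h2, h3, h4⟩ := exists_openStretch_right hIO (show I < c + P by omega) hcP1
      exact ⟨h, h1, by omega, h3, h4⟩
    · obtain ⟨h, h1, h2, h3, h4⟩ := exists_openStretch_right hIO (show I < c + P + P by omega) hcP2
      exact ⟨h, h1, by omega, h3, h4⟩
  obtain ⟨loI, hloIP, hloI, hopenL, hcloseL⟩ : ∃ lo, i < lo ∧ lo ≤ I ∧ (∀ l, lo ≤ l → l ≤ I → 𝒯.IsOpenSide d₀ l) ∧
      ¬ 𝒯.IsOpenSide d₀ (lo - 1) := by
    by_cases hcase : c < i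
    · obtain ⟨lo, h1, h2, h3, h4⟩ := exists_openStretch_left hIO (show c + P < I by omega) hcP1
      exact ⟨lo, by omega, h2, h3, h4⟩
    · obtain ⟨lo, h1, h2, h3, h4⟩ := exists_openStretch_left hIO (show c < I by omega) hc
      exact ⟨lo, by omega, h2, h3, h4⟩
  have hopenI : ∀ l, loI ≤ l → l ≤ hiI → 𝒯.IsOpenSide d₀ l := by
    intro l h1 h2
    rcases le_total l I with h | h
    · exact hopenL l h1 h
    · exact hopenR l h h2
  -- the port is shorter than the period: the closed side `loI - 1 + P` is not inside it
  have hshort : hiI < loI - 1 + P := by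
    by_contra hge
    push Not at hge
    have := hopenI (loI - 1 + P) (by omega) hge
    rw [hper1] at this
    exact hcloseL this
  -- the base and the final arc
  set r := hiI + 1 with hr
  have hrclosed : ¬ 𝒯.IsOpenSide d₀ r := hcloseR
  -- the representative `J ∈ (r, r + P)` of `j`
  obtain ⟨J, q, hJq, hrJ, hJrP⟩ : ∃ J q, J = j + q * P ∧ r ≤ J ∧ J < r + P := by
    by_cases h1 : r ≤ j + P
    · exact ⟨j + P, 1, by ring, h1, by omega⟩
    · by_cases h2 : r ≤ j + 2 * P
      · exact ⟨j + 2 * P, 2, rfl, h2, by omega⟩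
      · exact ⟨j + 3 * P, 3, rfl, by omega, by omega⟩
  have hJO : 𝒯.IsOpenSide d₀ J := by rw [hJq, hper]; exact hjO
  have hrJ' : r < J := lt_of_le_of_ne hrJ fun h => hrclosed (h ▸ hJO)
  -- `J` lies strictly before the closed side `loI - 1 + P` (else it would be that closed side or in the port of `i`)
  have hcloseL' : ¬ 𝒯.IsOpenSide d₀ (loI - 1 + P) := by rw [hper1]; exact hcloseL
  have hJlt : J < loI - 1 + P := by
    by_contra hge
    push Not at hge
    rcases hge.lt_or_eq with hlt | heq
    · -- `J ∈ [loI + P, hiI + P + 1) = copy of the port of `i`` : same port as `i`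
      apply hns
      refine ⟨2, q, loI + P, hiI + P, by omega, by omega, by rw [← hJq]; omega, by rw [← hJq]; omega, fun l hl1 hl2 => ?_⟩
      have := hopenI (l - P) (by omega) (by omega)
      rwa [← hper1, show l - P + P = l by omega] at this
    · exact hcloseL' (heq ▸ hJO)
  -- the port of `J`
  obtain ⟨hiJ, hJhiJ, hhiJ, hopenJR, hcloseJR⟩ := exists_openStretch_right hJO hJlt hcloseL'
  obtain ⟨loJ, hrloJ, hloJJ, hopenJL, hcloseJL⟩ := exists_openStretch_left hJO hrJ' hrclosed
  have hopenJ : ∀ l, loJ ≤ l → l ≤ hiJ → 𝒯.IsOpenSide d₀ l := by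
    intro l h1 h2
    rcases le_total l J with h | h
    · exact hopenJL l h1 h
    · exact hopenJR l h h2
  -- the arcs `a = (0, loJ - r, hiJ + 1 - r, loI + P - r)` and the representatives
  refine ⟨r, ![0, loJ - r, hiJ + 1 - r, loI + P - r], I + P - r, J - r, rfl, ?_, ?_, ⟨?_, ?_⟩, ⟨?_, ?_⟩, ?_, ⟨q, ?_⟩,
    ?_, ?_, ?_, ?_, ?_, ?_⟩
  · refine Fin.strictMono_iff_lt_succ.2 fun k => ?_
    fin_cases k
    · show 0 < loJ - r; omega
    · show loJ - r < hiJ + 1 - r; omega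
    · show hiJ + 1 - r < loI + P - r; omega
  · show loI + P - r < P; omega
  · show loI + P - r ≤ I + P - r; omega
  · show I + P - r < P; omega
  · show loJ - r ≤ J - r; omega
  · show J - r < hiJ + 1 - r; omega
  · omega
  · rw [show r + (J - r) = J by omega, hJq]
  · intro l hl1 hl2
    change loI + P - r ≤ l at hl1
    rw [isOpenSide_rebase]
    have := hopenI (r + l - P) (by omega) (by omega)
    rwa [← hper1, show r + l - P + P = r + l by omega] at this
  · intro l hl1 hl2
    change loJ - r ≤ l at hl1
    change l < hiJ + 1 - r at hl2
    rw [isOpenSide_rebase]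
    exact hopenJ (r + l) (by omega) (by omega)
  · rw [isOpenSide_rebase, add_zero]; exact hrclosed
  · show ¬ 𝒯.IsOpenSide (bdOrbit 𝒯.U d₀ r) (loJ - r - 1)
    rw [isOpenSide_rebase, show r + (loJ - r - 1) = loJ - 1 by omega]; exact hcloseJL
  · show ¬ 𝒯.IsOpenSide (bdOrbit 𝒯.U d₀ r) (hiJ + 1 - r)
    rw [isOpenSide_rebase, show r + (hiJ + 1 - r) = hiJ + 1 by omega]; exact hcloseJR
  · show ¬ 𝒯.IsOpenSide (bdOrbit 𝒯.U d₀ r) (loI + P - r - 1)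
    rw [isOpenSide_rebase, show r + (loI + P - r - 1) = loI - 1 + P by omega]; exact hcloseL'

end TileData

end CellComplex

end Literature.Probability.Percolation

end
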